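import Summits.BirchSwinnertonDyer.BirchSwinnertonDyer.Theorems.GenusKolyvaginAtTwoOffCutResidualAtTwoRLw2PhantomExclusionRatSelmer
import Summits.BirchSwinnertonDyer.BirchSwinnertonDyer.Theorems.GenusKolyvaginAtTwoPowDvdShaCardAtTwoRTNonPhantomAdditive
import Literature.NumberTheory.EllipticCurves.RootNumberTwistProofs
import Literature.NumberTheory.EllipticCurves.ModularityVersionApProofs
import HarnessLib

/-!
# Route `GenusKolyvaginAtTwo`, K₄⁻ kernel `K4Neg` (stmt-BirchSwinnertonDyer-31526), LINE 34 «twin_bsd_road⁻» v1.3 STUB F4″⁻ —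
# OFF THE CUT, `(NPh_K)` IS ONE 2-ADIC BIT OF `E`: «the Lawson–Wuthrich class `ξ_E` is not a Kummer class at `ℚ₂`», THE SAME AT EVERY FRAME

Width seat `bsd-line-gk2-p4` g32 (cell `bsd-f1-sign2`), WIDTH-5 attach on route `GenusKolyvaginAtTwo` rev 59; director rulings (642)(2)/(644)(b)
(the one GK2 width seat on F4′ = `(NPh_K)` off the cut, BOTH signs).  `--supports stmt-BirchSwinnertonDyer-31526 --as helper`.  THEOREMS ONLY (no
definition, no named fact, no `sorry`); standard axioms.  **BSD is NOT proved by this file; `K4Neg` is NOT proved; no item is closed by it.**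

WHAT.  For the `Δ > 0` sign this seat PROVED F4″ (`…K4PosTwinBsdRoadNonPhantomAtTwo`: the real place is the witness).  For `Δ < 0` the real place
is silent, and the pen's LINE 34 v1.3 reads its only stub F4″⁻ `stub_offCutNonPhantomAtTwo` as «a statement about `E/ℚ₂` only».  This file makes
that reading a kernel theorem, SIGN-FREE: on the OFF-CUT habitat (`C(E)` odd, no odd multiplicative prime, `ρ_{E,2^n}` onto) and at ANY `2`-split
Heegner frame `K`,
* ★ `nonPhantom_pow_iff_forall_not_mem_selmerLocalKer_two_of_offCut` — **`(NPh_M)(E, K)` for every `M ≥ 1` ⟺ every non-zero `x ∈ H¹(ℚ, E[2])`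
  dying on `Γ_{ℚ(E[4])}` (the Lawson–Wuthrich class `ξ_E`; there is exactly one) is NOT in `selmerLocalKer E ℚ_{v₂} 2`**, `v₂` the place of `ℚ`
  over `2`.  The right-hand side mentions neither `K` nor any place other than `2`: so F4″⁻ for a given curve holds at ALL `2`-split Heegner frames
  or at NONE, and its falsifier is ONE local computation per curve («is `ξ_E = [−Δ·F′(e)]` in the image of `E(ℚ₂)/2E(ℚ₂) → H¹(ℚ₂, E[2])`»).
  Proof: g31's sign-free criterion `nonPhantom_pow_iff_exists_finite_place_rat` (a finite witness prime exists) and the SILENCE of every other finite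
  prime for such a class: off `2N` it is Kummer (`mem_selmerLocalKer_rat_of_forall_torsionFixing_four_of_notMem`, good reduction + NOS), and at an odd
  `ℓ ∣ N` — additive off the cut (`hoff`, `dvd_conductorNorm_iff_not_hasGoodReductionAtPrime`,
  `hasMultiplicativeReductionAtPrime_iff_hasMultiplicativeReductionAt_ringOfIntegers`) with `c_ℓ` odd — `H¹(ℚ_ℓ, E[2]) = 0` swallows EVERY class
  (gk2-p5 g20 `NonPhantom.mem_selmerLocalKer_and_mem_torsionLocalKer_of_additive_of_odd_tamagawaProduct`).
* `mem_selmerLocalKer_rat_of_offCut_of_ne_two` — the silence lemma over `ℚ` in place form (every class of `H¹(ℚ, E[2])` dying on `Γ_{ℚ(E[4])}` is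
  Kummer at every finite `v ≠ v₂`, off the cut).
READING for LINE 34 (K₄⁻, `Δ < 0`; census, nothing closed): F4″⁻ ⟺ «`ξ_E ∉ 𝓛₂`» per curve.  Poitou–Tate at `T = {2}` splits the off-cut K₄⁻ cell
(where `ξ_E ∈ Sel₂^{rel 2}(E)` always): if `E(ℚ₂)[2] = 0` and some `2`-Selmer class of `E` is non-trivial in `H¹(ℚ₂, E[2])`, then `Sel₂^{rel 2} = Sel₂`
and F4″⁻ FAILS for `E` (a `2`-adically VISIBLE Selmer class kills every `(NPh)`-fed engine — the `Δ < 0` mirror of the `Δ > 0` real clause works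
AGAINST the line); if `E(ℚ₂)[2] = 0` and `Sel₂(E)` is `2`-adically strict, F4″⁻ ⟺ `res_{D₂} ξ_E ≠ 0` (a property of `D₂ ≤ GL₂(ℤ/4)` alone).  That
dichotomy is recorded as the falsifier spec (memo `F4PRIME-K4POS-gk2p4-g32.md`, evidence on 31526); it is NOT proved in this file.
BSD is NOT proved by any of this.

References: [LawsonWuthrich2016] §3, §7.1, §8; [GrossLMS1991] §7 (7.1), (7.4), §9; [MilneADT2006] I Cor. 2.3, Thm. 2.8, Thm. 4.10;
[MazurRubin2010] Lemma 3.2; [SilvermanAEC2009] VII.2.1, VII.3.1, X.4.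
-/

set_option autoImplicit false
set_option linter.dupNamespace false -- `Summit.<P>.<Sub>` repeats `BirchSwinnertonDyer` (D-0017)

noncomputable section

open scoped Classical NumberField

namespace Summit.BirchSwinnertonDyer.BirchSwinnertonDyer.Theorems.GenusExact.Lw2PhantomExclusion.TwoAdic

open WeierstrassCurve Field NumberField IsDedekindDomain Rat.HeightOneSpectrum
open Literature.NumberTheory.EllipticCurves Literature.NumberTheory.GaloisRepresentations
open Summit.BirchSwinnertonDyer.BirchSwinnertonDyer.Theorems.GenusExact.VisiblePairAtTwo (natCast_prime_mem_iff_eq natCast_mem_primesEquiv_symm)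

variable (W : WeierstrassCurve ℚ) [W.IsElliptic] [W.IsGloballyMinimal] [NeZero (W.conductorNorm ℤ)]

/-! ## §7 Off the cut every finite place other than `v₂` is silent for the Lawson–Wuthrich class -/

/-- **Off the cut, a class of `H¹(ℚ, E[2])` dying on `Γ_{ℚ(E[4])}` is Kummer at every finite place `v` of `ℚ` not over `2`.**  `W/ℚ` globally
minimal elliptic, `C(W)` odd, no odd multiplicative prime.  If `2N ∉ v`: good reduction, the class is unramified hence Kummer (g31).  If `2N ∈ v`,
`2 ∉ v`: the prime `ℓ` under `v` is odd, divides `N` (not good), is not multiplicative (off the cut), so `E` is additive at `ℓ` with `c_ℓ` odd and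
`H¹(ℚ_ℓ, E[2]) = 0` (gk2-p5 g20): every class is Kummer there. [cite: GrossLMS1991, §7 (7.1), (7.4)] [cite: MilneADT2006, Ch. I, Cor. 2.3 and Thm. 2.8]
[cite: SilvermanAEC2009, VII.2 Prop. 2.1, VII.3 Prop. 3.1] -/
theorem mem_selmerLocalKer_rat_of_offCut_of_ne_two (hT : Odd W.tamagawaProduct)
    (hoff : ¬ ∃ v : HeightOneSpectrum (𝓞 ℚ), ((2 : ℕ) : 𝓞 ℚ) ∉ v.asIdeal ∧ ((W.conductorNorm ℤ : ℕ) : 𝓞 ℚ) ∈ v.asIdeal ∧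
      W.HasMultiplicativeReductionAt v)
    (v : HeightOneSpectrum (𝓞 ℚ)) (h2v : ((2 : ℕ) : 𝓞 ℚ) ∉ v.asIdeal)
    {x : galH1Torsion W (2 : ℤ)} (hx : ∀ ρ ∈ torsionFixing W (4 : ℤ), h1Eval W (2 : ℤ) x ρ = 0) :
    x ∈ selmerLocalKer W (v.adicCompletion ℚ) (2 : ℤ) := by
  have hN0 : W.conductorNorm ℤ ≠ 0 := NeZero.ne _
  by_cases h2Nv : ((2 * W.conductorNorm ℤ : ℕ) : 𝓞 ℚ) ∈ v.asIdeal
  swap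
  · exact mem_selmerLocalKer_rat_of_forall_torsionFixing_four_of_notMem W v h2Nv hx
  -- `v ∋ N`, `v ∌ 2`: the prime under `v` is an odd additive prime with odd Tamagawa number
  have hNv : ((W.conductorNorm ℤ : ℕ) : 𝓞 ℚ) ∈ v.asIdeal := by
    rw [Nat.cast_mul] at h2Nv
    exact (v.isPrime.mem_or_mem h2Nv).resolve_left h2v
  obtain ⟨ℓ, hℓp, hℓN, hℓv⟩ := v.asIdeal.exists_prime_dvd_and_natCast_mem hN0 hNv
  have hveq : v = primesEquiv.symm ⟨ℓ, hℓp⟩ := (natCast_prime_mem_iff_eq hℓp v).mp hℓv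
  have hvℓ : ((primesEquiv v : Nat.Primes) : ℕ) = ℓ := by rw [hveq, Equiv.apply_symm_apply]
  subst hvℓ
  haveI : Fact ((primesEquiv v : Nat.Primes) : ℕ).Prime := ⟨hℓp⟩
  have hℓ2 : ((primesEquiv v : Nat.Primes) : ℕ) ≠ 2 := by
    intro h
    rw [h] at hℓv
    exact h2v hℓv
  have hng : ¬ W.HasGoodReductionAtPrime ((primesEquiv v : Nat.Primes) : ℕ) :=
    (W.dvd_conductorNorm_iff_not_hasGoodReductionAtPrime _).mp hℓN
  have hnm : ¬ W.HasMultiplicativeReductionAtPrime ((primesEquiv v : Nat.Primes) : ℕ) := fun hm ↦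
    hoff ⟨v, h2v, hNv, (W.hasMultiplicativeReductionAtPrime_iff_hasMultiplicativeReductionAt_ringOfIntegers v).mp hm⟩
  exact (NonPhantom.mem_selmerLocalKer_and_mem_torsionLocalKer_of_additive_of_odd_tamagawaProduct W _ hℓ2 hng hnm hT v hℓv 1 x).1

/-! ## §8 ★ `(NPh_K)` off the cut is ONE 2-adic bit of `E`, the same at every `2`-split Heegner frame -/

/-- ★ **OFF THE CUT, `(NPh)` ⟺ THE LAWSON–WUTHRICH CLASS IS NOT A KUMMER CLASS AT `ℚ₂`** (sign-free; the exact `E`-intrinsic content of LINE 34's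
F4″⁻ and of LINE 33's F4″).  Frame: `W/ℚ` globally minimal elliptic with `C(W)` odd and NO odd multiplicative prime, `ρ_{E,2^n}` onto for all `n`;
`K` imaginary quadratic, `d_K` odd, `d_K·(−|Δ|)` and `d_K·(−2|Δ|)` non-squares, Heegner for `N_W`, `2` SPLIT in `K`.  Then `(NPh_M)(W, K)` holds for
every `M ≥ 1` (every class of `H¹(K, E[2^M])` dying on `Γ_{K(E[2^M])}` and Kummer at the places over `2N` is `0`) **iff** every non-zero
`x ∈ H¹(ℚ, E[2])` dying on `Γ_{ℚ(E[4])}` lies OUTSIDE `selmerLocalKer W ℚ_{v₂} 2`, `v₂` the place over `2`.  The right-hand side is independent of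
`K`: for a given curve F4″⁻ holds at every `2`-split Heegner frame or at none, and it is decided by ONE local `2`-descent datum of `E`.  For `Δ > 0`
with the K₄⁺ real clause the right-hand side HOLDS (`…K4PosTwinBsdRoadNonPhantom`); for `Δ < 0` it is open per curve.  BSD is NOT proved by this.
[cite: LawsonWuthrich2016, §3, §7.1, §8] [cite: GrossLMS1991, §9 Prop. 9.1] [cite: MilneADT2006, Ch. I, Cor. 2.3, Thm. 2.8] -/
theorem nonPhantom_pow_iff_forall_not_mem_selmerLocalKer_two_of_offCut {K : Type} [Field K] [NumberField K]
    (hρ : ∀ n : ℕ, 0 < n → W.HasSurjectiveModNGaloisRep ((2 : ℤ) ^ n)) (hT : Odd W.tamagawaProduct)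
    (hoff : ¬ ∃ v : HeightOneSpectrum (𝓞 ℚ), ((2 : ℕ) : 𝓞 ℚ) ∉ v.asIdeal ∧ ((W.conductorNorm ℤ : ℕ) : 𝓞 ℚ) ∈ v.asIdeal ∧
      W.HasMultiplicativeReductionAt v)
    (hK : IsImaginaryQuadratic K) (hodd : Odd (NumberField.discr K)) (hnsq₁ : ¬ IsSquare ((NumberField.discr K : ℚ) * -|W.Δ|))
    (hnsq₂ : ¬ IsSquare ((NumberField.discr K : ℚ) * (-(2 * |W.Δ|))))
    (hH : SatisfiesHeegnerHypothesis (W.conductorNorm ℤ) K) (h2 : ((Ideal.span {(2 : ℤ)}).primesOver (𝓞 K)).ncard = 2) :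
    (∀ (Mlev : ℕ), 1 ≤ Mlev → ∀ z : galH1Torsion (W.baseChange K) ((2 ^ Mlev : ℕ) : ℤ),
        (∀ ρ ∈ torsionFixing (W.baseChange K) ((2 ^ Mlev : ℕ) : ℤ), h1Eval (W.baseChange K) ((2 ^ Mlev : ℕ) : ℤ) z ρ = 0) →
        (∀ w : HeightOneSpectrum (𝓞 K), ((2 * W.conductorNorm ℤ : ℕ) : 𝓞 K) ∈ w.asIdeal →
          z ∈ selmerLocalKer (W.baseChange K) (w.adicCompletion K) ((2 ^ Mlev : ℕ) : ℤ)) → z = 0) ↔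
      ∀ x : galH1Torsion W (2 : ℤ), x ≠ 0 → (∀ h ∈ torsionFixing W (4 : ℤ), h1Eval W (2 : ℤ) x h = 0) →
        x ∉ selmerLocalKer W ((primesEquiv.symm ⟨2, Nat.prime_two⟩ : HeightOneSpectrum (𝓞 ℚ)).adicCompletion ℚ) (2 : ℤ) := by
  rw [nonPhantom_pow_iff_exists_finite_place_rat W hρ hK hodd hnsq₁ hnsq₂ (NeZero.ne _) hH h2]
  refine forall_congr' fun x ↦ forall_congr' fun hx0 ↦ forall_congr' fun hx ↦ ?_
  constructor
  · rintro ⟨v, hv⟩ h2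
    by_cases h2v : ((2 : ℕ) : 𝓞 ℚ) ∈ v.asIdeal
    · have hveq : v = primesEquiv.symm ⟨2, Nat.prime_two⟩ := (natCast_prime_mem_iff_eq Nat.prime_two v).mp h2v
      subst hveq
      exact hv h2
    · exact hv (mem_selmerLocalKer_rat_of_offCut_of_ne_two W hT hoff v h2v hx)
  · intro h
    exact ⟨_, h⟩

end Summit.BirchSwinnertonDyer.BirchSwinnertonDyer.Theorems.GenusExact.Lw2PhantomExclusion.TwoAdic

end
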